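import Summits.CriticalPhenomena.PercolationContinuityZ3.Theorems.PercNearOneGluingNoHeavyLowerTailSahiTwoLevelKappa
import Summits.CriticalPhenomena.PercolationContinuityZ3.Theorems.PercNearOneGluingNoHeavyLowerTailSahiJuntaSlotExtension

/-!
# PLUS′ (hence the two-level TOP law `SahiTwoLevelPlus`) HOLDS whenever two of the top events have disjoint supports

Support file of the one-cut programme (crux `NoHeavyLowerTail`, stmt-CriticalPhenomena-4575; cell `prim-bnk`, seat bnk-2 gen 16,
memo `run/shared/lean/prim/prim-l12/FROM-prim-bnk-2-g16-INDEPENDENT-TOPS.md`; INEQ-CLAIMS rows PLUS′ / COMB-PLUS′).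

Recall (`…SahiTwoLevelKappa`): for a nested pair `H_i ⊆ G_i` (`i = 0,1,2`) of triples of increasing events under a product
measure `μ`, PLUS′ is the inequality
  `κ₃(G) + Σ_k (μ(G_k) − μ(H_k))·Cov(G_i,G_j) + Σ_k Cov(H_i ∩ H_j, G_k) ≥ 0`
(`SahiTwoLevelPlusPrime`, OPEN in general; it implies `SahiTwoLevelPlus`, hence Sahi's `C_3` on product measures and Kahn's
Conjecture 5).  Its COEFFICIENTWISE (three-copy comb) version `c_2 − c_3 ≥ ρ_e` is FALSE on five coins (ttrl cp-s2top
`PLUSPRIME.md`, 2026-08-21; seven cells on three class triples): all of them live on ONE architecture — in each of the three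
triples the sections `G₀`, `G₁` of the first two events along the axis are determined by DISJOINT pairs of coins, `G₂` is a
two-coin bridge and `H₂ = ∅` (minimal witness `U = ((x₁∨x₄)(x₂∨x₃), (x₀∨x₄)(x₁∨x₃), x₁(x₀∨x₂))`, axis `x₁`: `G₀ = x₂ ∨ x₃`,
`G₁ = x₀ ∨ x₄`, `G₂ = x₀ ∨ x₂`, `H₀ = G₀ ∧ x₄`, `H₁ = G₁ ∧ x₃`, `H₂ = ∅`; checked for all three triples, bnk-2 gen 16).

**THEOREM (this file, `twoLevelPlusPrime_nonneg_of_determinedBy`).**  If `G₀` is determined by the coins outside a set `T` and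
`G₁` by the coins in `T` (so `G₀ ⟂ G₁`), then PLUS′ holds at `(G,H)` for EVERY increasing `G₂` and every nested increasing
`H ≤ G` — under every product measure, on every finite cube.  Hence `T⁺(G,H) ≥ r₂(G,H) ≥ 0` (`SahiTwoLevelPlus` at such pairs,
`twoLevelPlus_nonneg_of_determinedBy`) and `twoLevelForm ≥ 0` (`twoLevelForm_nonneg_of_determinedBy`).  So the measure-level
law is a THEOREM exactly on the architecture where its comb shadow fails: no comb counterexample of this shape can ever be
realised by a product measure.  (At `H = G` the statement is Sahi's `E_3 ≥ 0` for a triple with two independent members,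
already in the tree as `Literature.Probability.LatticeModels.prodBernoulli_sahiE3_nonneg_of_determinedBy`; the content here is
the extension to all nested bottoms `H`, where the comb law breaks.)

PROOF (new; elementary).  Write `A = G₀`, `B = G₁`, `U = G₂`, `W = H₀ ∩ H₁ ⊆ A ∩ B`, `a,b,u,w,h₀,h₁` for the measures.
(1) Independence `μ(A ∩ B) = ab` turns PLUS′ into `Φ + Cov(H₁H₂,G₀) + Cov(H₀H₂,G₁)` with
    `Φ = C + D − h₀α − h₁β`, `C = Cov(1_{A∩B},1_U)`, `D = Cov(1_W,1_U)`, `α = Cov(1_B,1_U)`, `β = Cov(1_A,1_U)` (all `≥ 0`, Harris).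
(2) `0 ≤ h₀ ≤ a`, `0 ≤ h₁ ≤ b`, `h₀h₁ ≤ μ(H₀)μ(H₁) ≤ w ≤ ab` (Harris).
(3) **ENDPOINT ROWS** (`endpoint_row`): `b(C + D) ≥ wα + b²β`, i.e. `b·μ(W∩U) + b·μ(A∩B∩U) ≥ w·μ(B∩U) + b²·μ(A∩U)`, and its mirror
    `a(C + D) ≥ a²α + wβ`.  Proof by RESAMPLING THE `T`-BLOCK (`SahiHittingSlot.pr_eq_sum_loc`): with `F_X(ω) = μ(loc_T ω X)` the
    probability of the section of `X` over the outside configuration `ω`, `μ(W∩U) = E_ω F_{W∩U} ≥ E_ω[F_W F_U]` (Harris on each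
    section), `w·μ(B∩U) = E[F_W]·E[F_{B∩U}] ≤ E[F_W F_{B∩U}]` (Harris for the increasing FUNCTIONS `F_W, F_{B∩U}` of the outside
    configuration), `μ(A∩B∩U) = E[1_A F_{B∩U}]`, `μ(A∩U) = E[1_A F_U]` (`A` is determined by the outside, `B` by the inside), and
    pointwise `b F_W F_U − F_W F_{B∩U} + 1_A(b F_{B∩U} − b² F_U) = 1_A (b − F_W)(F_{B∩U} − b F_U) ≥ 0` (`F_W ≤ b`, `F_W = 0` off `A`,
    Harris `F_{B∩U} ≥ b F_U`).
(4) Elementary algebra (`endpoint_interpolation`): (2) and the two endpoint rows give `h₀α + h₁β ≤ C + D` (the worst nested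
    bottoms sit at the two corners `(h₀,h₁) = (a, w/a)`, `(w/b, b)` of the region `h₀h₁ ≤ w`).
Everything here is proved; axioms standard; PLUS′ / `SahiTwoLevelPlus` / `C_3` in general remain OPEN (obligations, never facts).
Census behind the statement (bnk-2 gen 15/16): PLUS′ measure-level `m = 5` exhaustive at nine uniform `q`, min exactly `0`; the
endpoint rows exhaustive on `≤ 5` coins (all `(A,B,W,U)`), min exactly `0`. [this work]
-/

noncomputable section

open scoped Classical

namespace Summit.CriticalPhenomena.PercolationContinuityZ3.Theorems

namespace SahiTwoLevelIndep

open Finset MeasureTheory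
open Literature.Combinatorics.Sahi2008
open Literature.Probability.LatticeModels (prodBernoulli prodBernoulli_harris prodBernoulli_real_inter_of_determinedBy)
open Literature.Probability.Percolation (DeterminedBy determinedBy_iff)
open Literature.Probability.Percolation.BHK2006 (weight weight_nonneg harris sum_affine ind_inter ind_mono)
open Literature.Probability.Percolation.DecisionTree (ind ind_of_mem ind_of_not_mem ind_nonneg)
open SahiHittingSlot (pr pr_eq_sum pr_nonneg pr_mono p_nonneg p_le_one bw_nonneg loc mem_loc isUpperSet_loc loc_inter
  pr_eq_sum_loc cov_nonneg loc_eq_self_of_determinedBy)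

variable {ι : Type} [Fintype ι]

/-! ### Localisations over the outside configuration: three more facts -/

omit [Fintype ι] in
/-- For an event determined by the coins OUTSIDE `T`, membership of a localisation `loc_T ω X` is membership of the outside
configuration `ω` itself. [this work] -/
theorem mem_loc_iff_of_determinedBy_compl (T : Finset ι) {X : Set (Set ι)} (hX : DeterminedBy X (↑T : Set ι)ᶜ)
    (ω ζ : Set ι) : ζ ∈ loc T ω X ↔ ω ∈ X := by
  rw [mem_loc]
  exact (determinedBy_iff X _).1 hX _ _ (Set.ite_inter_compl_self _ _ _)

omit [Fintype ι] in
/-- Localisations are monotone in the outside configuration (for increasing events). [this work] -/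
theorem loc_mono_outside (T : Finset ι) {X : Set (Set ι)} (hX : IsUpperSet X) {ω ω' : Set ι} (h : ω ≤ ω') :
    loc T ω X ⊆ loc T ω' X :=
  fun _ hζ => hX (Set.ite_mono _ le_rfl h) hζ

omit [Fintype ι] in
/-- Localisation is monotone in the event. [this work] -/
theorem loc_mono_event (T : Finset ι) (ω : Set ι) {X Y : Set (Set ι)} (h : X ⊆ Y) : loc T ω X ⊆ loc T ω Y :=
  fun _ hζ => h hζ

/-- `μ(∅) = 0` under the product weight. [folklore] -/
theorem pr_empty (p : ι → unitInterval) : pr p (∅ : Set (Set ι)) = 0 := by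
  rw [pr_eq_sum]
  exact sum_eq_zero fun ω _ => by rw [ind_of_not_mem (Set.notMem_empty ω), mul_zero]

/-! ### The section probabilities `F_X(ω) = μ(loc_T ω X)` as functions of the outside configuration -/

/-- `F_X(ω) = μ(loc_T ω X)` is an increasing function of the outside configuration when `X` is increasing. [this work] -/
theorem monotone_pr_loc (p : ι → unitInterval) (T : Finset ι) {X : Set (Set ι)} (hX : IsUpperSet X) :
    Monotone fun ω => pr p (loc T ω X) :=
  fun _ _ h => pr_mono p (loc_mono_outside T hX h)

/-- `F_X(ω)` is monotone in the event. [this work] -/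
theorem pr_loc_mono (p : ι → unitInterval) (T : Finset ι) {X Y : Set (Set ι)} (h : X ⊆ Y) (ω : Set ι) :
    pr p (loc T ω X) ≤ pr p (loc T ω Y) :=
  pr_mono p (loc_mono_event T ω h)

/-- **Resampling the `T`-block**: `μ(X) = Σ_ω w(ω) F_X(ω)` (`SahiHittingSlot.pr_eq_sum_loc`). [folklore] -/
theorem pr_eq_sum_pr_loc (p : ι → unitInterval) (T : Finset ι) (X : Set (Set ι)) :
    pr p X = ∑ ω, bernoulliWeight p ω * pr p (loc T ω X) :=
  pr_eq_sum_loc p T X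

/-- **Harris on each section**: `F_X(ω) F_Y(ω) ≤ F_{X∩Y}(ω)` for increasing `X, Y`. [this work] -/
theorem pr_loc_mul_le_inter (p : ι → unitInterval) (T : Finset ι) {X Y : Set (Set ι)} (hX : IsUpperSet X)
    (hY : IsUpperSet Y) (ω : Set ι) : pr p (loc T ω X) * pr p (loc T ω Y) ≤ pr p (loc T ω (X ∩ Y)) := by
  rw [loc_inter]
  linarith [cov_nonneg p (isUpperSet_loc T ω hX) (isUpperSet_loc T ω hY)]

/-- **Harris for the section probabilities as functions of the outside configuration**:
`μ(X) μ(Y) ≤ Σ_ω w(ω) F_X(ω) F_Y(ω)` for increasing `X, Y`. [this work] -/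
theorem pr_mul_pr_le_sum_pr_loc_mul (p : ι → unitInterval) (T : Finset ι) {X Y : Set (Set ι)} (hX : IsUpperSet X)
    (hY : IsUpperSet Y) : pr p X * pr p Y ≤ ∑ ω, bernoulliWeight p ω * (pr p (loc T ω X) * pr p (loc T ω Y)) := by
  have h := harris (w := fun e => (p e : ℝ)) (p_nonneg p) (p_le_one p) (f := fun ω => pr p (loc T ω X))
    (g := fun ω => pr p (loc T ω Y)) (fun ω => pr_nonneg p (loc T ω X)) (fun ω => pr_nonneg p (loc T ω Y))
    (monotone_pr_loc p T hX) (monotone_pr_loc p T hY)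
  rw [show (∑ ω, weight (fun e => (p e : ℝ)) ω) = 1 from sum_bernoulliWeight p, one_mul] at h
  rw [pr_eq_sum_pr_loc p T X, pr_eq_sum_pr_loc p T Y]
  exact h

/-- An event determined by `T` is its own section: `F_{B ∩ X}(ω) = μ(B ∩ loc_T ω X)`. [this work] -/
theorem pr_loc_inter_of_determinedBy (p : ι → unitInterval) (T : Finset ι) {B : Set (Set ι)}
    (hB : DeterminedBy B (↑T : Set ι)) (X : Set (Set ι)) (ω : Set ι) :
    pr p (loc T ω (B ∩ X)) = pr p (B ∩ loc T ω X) := by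
  rw [loc_inter, loc_eq_self_of_determinedBy T ω hB]

/-- An event determined by `T` has constant section probability `μ(B)`. [this work] -/
theorem pr_loc_of_determinedBy (p : ι → unitInterval) (T : Finset ι) {B : Set (Set ι)}
    (hB : DeterminedBy B (↑T : Set ι)) (ω : Set ι) : pr p (loc T ω B) = pr p B := by
  rw [loc_eq_self_of_determinedBy T ω hB]

/-- An event determined by the OUTSIDE of `T` factors out of section probabilities as its indicator:
`F_{A ∩ X}(ω) = 1_A(ω) F_X(ω)`. [this work] -/
theorem pr_loc_inter_of_determinedBy_compl (p : ι → unitInterval) (T : Finset ι) {A : Set (Set ι)}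
    (hA : DeterminedBy A (↑T : Set ι)ᶜ) (X : Set (Set ι)) (ω : Set ι) :
    pr p (loc T ω (A ∩ X)) = ind A ω * pr p (loc T ω X) := by
  rw [loc_inter]
  by_cases hω : ω ∈ A
  · have hl : loc T ω A = Set.univ :=
      Set.eq_univ_of_forall fun ζ => (mem_loc_iff_of_determinedBy_compl T hA ω ζ).2 hω
    rw [hl, Set.univ_inter, ind_of_mem hω, one_mul]
  · have hl : loc T ω A = ∅ :=
      Set.eq_empty_of_forall_notMem fun ζ hζ => hω ((mem_loc_iff_of_determinedBy_compl T hA ω ζ).1 hζ)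
    rw [hl, Set.empty_inter, pr_empty, ind_of_not_mem hω, zero_mul]

/-- Off an outside-determined event `A`, every sub-event of `A` has section probability `0`. [this work] -/
theorem pr_loc_eq_zero_of_subset_of_not_mem (p : ι → unitInterval) (T : Finset ι) {A W : Set (Set ι)}
    (hA : DeterminedBy A (↑T : Set ι)ᶜ) (hWA : W ⊆ A) {ω : Set ι} (hω : ω ∉ A) : pr p (loc T ω W) = 0 := by
  refine le_antisymm ?_ (pr_nonneg p (loc T ω W))
  have h := pr_loc_mono p T hWA ω
  have hA' : pr p (loc T ω A) = 0 := by
    have := pr_loc_inter_of_determinedBy_compl p T hA Set.univ ω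
    rw [Set.inter_univ, ind_of_not_mem hω, zero_mul] at this
    exact this
  linarith

/-! ### The endpoint row -/

/-- **THE ENDPOINT ROW (R2\*).**  For increasing events `A` (determined by the coins outside `T`), `B` (determined by `T`),
`W ⊆ A ∩ B` and `U`, under every product weight:
  `μ(W)·μ(B ∩ U) ≤ μ(B)·( μ(W ∩ U) + μ(A ∩ B ∩ U) − μ(B)·μ(A ∩ U) )`.
(Resampling of the `T`-block, Harris on each section, Harris for the section probabilities as functions of the outside
configuration, and the pointwise identity `1_A (b − F_W)(F_{B∩U} − b F_U) ≥ 0`.) [this work] -/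
theorem endpoint_row (p : ι → unitInterval) (T : Finset ι) {A B W U : Set (Set ι)}
    (hB : IsUpperSet B) (hW : IsUpperSet W) (hU : IsUpperSet U)
    (hA : DeterminedBy A (↑T : Set ι)ᶜ) (hBT : DeterminedBy B (↑T : Set ι)) (hWA : W ⊆ A) (hWB : W ⊆ B) :
    pr p W * pr p (B ∩ U) ≤ pr p B * (pr p (W ∩ U) + pr p (A ∩ B ∩ U) - pr p B * pr p (A ∩ U)) := by
  set b := pr p B with hb
  have hb0 : 0 ≤ b := pr_nonneg p B
  -- (i) Harris on each section of `W ∩ U`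
  have h1 : ∑ ω, bernoulliWeight p ω * (pr p (loc T ω W) * pr p (loc T ω U)) ≤ pr p (W ∩ U) := by
    rw [pr_eq_sum_pr_loc p T (W ∩ U)]
    exact sum_le_sum fun ω _ => mul_le_mul_of_nonneg_left (pr_loc_mul_le_inter p T hW hU ω) (bw_nonneg p ω)
  -- (ii) Harris for the section probabilities of `W` and `B ∩ U` as functions of the outside configuration
  have h2 : pr p W * pr p (B ∩ U) ≤ ∑ ω, bernoulliWeight p ω * (pr p (loc T ω W) * pr p (loc T ω (B ∩ U))) :=
    pr_mul_pr_le_sum_pr_loc_mul p T hW (hB.inter hU)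
  -- (iii) the two moments through `A`
  have h3 : pr p (A ∩ B ∩ U) = ∑ ω, bernoulliWeight p ω * (ind A ω * pr p (loc T ω (B ∩ U))) := by
    rw [Set.inter_assoc, pr_eq_sum_pr_loc p T]
    exact sum_congr rfl fun ω _ => by rw [pr_loc_inter_of_determinedBy_compl p T hA]
  have h4 : pr p (A ∩ U) = ∑ ω, bernoulliWeight p ω * (ind A ω * pr p (loc T ω U)) := by
    rw [pr_eq_sum_pr_loc p T]
    exact sum_congr rfl fun ω _ => by rw [pr_loc_inter_of_determinedBy_compl p T hA]
  -- (iv) the pointwise inequality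
  have hpt : ∀ ω, 0 ≤ b * (pr p (loc T ω W) * pr p (loc T ω U)) + b * (ind A ω * pr p (loc T ω (B ∩ U)))
      + (-(b * b)) * (ind A ω * pr p (loc T ω U)) + (-1) * (pr p (loc T ω W) * pr p (loc T ω (B ∩ U))) := by
    intro ω
    have hWle : pr p (loc T ω W) ≤ b := (pr_loc_mono p T hWB ω).trans_eq (pr_loc_of_determinedBy p T hBT ω)
    have hβ : b * pr p (loc T ω U) ≤ pr p (loc T ω (B ∩ U)) := by
      rw [pr_loc_inter_of_determinedBy p T hBT]
      linarith [cov_nonneg p hB (isUpperSet_loc T ω hU)]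
    by_cases hω : ω ∈ A
    · rw [ind_of_mem hω]
      have hU0 := pr_nonneg p (loc T ω U)
      nlinarith [mul_nonneg (sub_nonneg.2 hWle) (sub_nonneg.2 hβ)]
    · rw [ind_of_not_mem hω, pr_loc_eq_zero_of_subset_of_not_mem p T hA hWA hω]
      simp
  have hsum : 0 ≤ ∑ ω, bernoulliWeight p ω * (b * (pr p (loc T ω W) * pr p (loc T ω U)) + b * (ind A ω * pr p (loc T ω (B ∩ U)))
      + (-(b * b)) * (ind A ω * pr p (loc T ω U)) + (-1) * (pr p (loc T ω W) * pr p (loc T ω (B ∩ U)))) :=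
    sum_nonneg fun ω _ => mul_nonneg (bw_nonneg p ω) (hpt ω)
  have hlin := sum_affine (fun e => (p e : ℝ))
    (fun ω => b * (pr p (loc T ω W) * pr p (loc T ω U)) + b * (ind A ω * pr p (loc T ω (B ∩ U)))
      + (-(b * b)) * (ind A ω * pr p (loc T ω U)) + (-1) * (pr p (loc T ω W) * pr p (loc T ω (B ∩ U))))
    (fun ω => pr p (loc T ω W) * pr p (loc T ω U)) (fun ω => ind A ω * pr p (loc T ω (B ∩ U)))
    (fun ω => ind A ω * pr p (loc T ω U)) (fun ω => pr p (loc T ω W) * pr p (loc T ω (B ∩ U)))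
    b b (-(b * b)) (-1) (fun ω => rfl)
  have hsum' : 0 ≤ b * ∑ ω, bernoulliWeight p ω * (pr p (loc T ω W) * pr p (loc T ω U))
      + b * ∑ ω, bernoulliWeight p ω * (ind A ω * pr p (loc T ω (B ∩ U)))
      + (-(b * b)) * ∑ ω, bernoulliWeight p ω * (ind A ω * pr p (loc T ω U))
      + (-1) * ∑ ω, bernoulliWeight p ω * (pr p (loc T ω W) * pr p (loc T ω (B ∩ U))) := by
    have h := hsum
    simp only [bernoulliWeight] at h ⊢
    rw [hlin] at h
    exact h
  rw [h3, h4]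
  have h1' := mul_le_mul_of_nonneg_left h1 hb0
  nlinarith [h1', h2, hsum']

/-- The endpoint row in `(prodBernoulli p).real` form. [this work] -/
theorem endpoint_row_real (p : ι → unitInterval) (T : Finset ι) {A B W U : Set (Set ι)}
    (hB : IsUpperSet B) (hW : IsUpperSet W) (hU : IsUpperSet U)
    (hA : DeterminedBy A (↑T : Set ι)ᶜ) (hBT : DeterminedBy B (↑T : Set ι)) (hWA : W ⊆ A) (hWB : W ⊆ B) :
    (prodBernoulli p).real W * (prodBernoulli p).real (B ∩ U) ≤
      (prodBernoulli p).real B * ((prodBernoulli p).real (W ∩ U) + (prodBernoulli p).real (A ∩ B ∩ U)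
        - (prodBernoulli p).real B * (prodBernoulli p).real (A ∩ U)) := by
  have h := endpoint_row p T hB hW hU hA hBT hWA hWB
  simp only [pr, ex_bernoulliWeight_ind] at h
  exact h

/-- **The mirrored endpoint row (R1\*)**: the same with the roles of the two supports exchanged —
`μ(W)·μ(A ∩ U) ≤ μ(A)·( μ(W ∩ U) + μ(A ∩ B ∩ U) − μ(A)·μ(B ∩ U) )`. [this work] -/
theorem endpoint_row_real' (p : ι → unitInterval) (T : Finset ι) {A B W U : Set (Set ι)}
    (hA : IsUpperSet A) (hW : IsUpperSet W) (hU : IsUpperSet U)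
    (hAT : DeterminedBy A (↑T : Set ι)ᶜ) (hBT : DeterminedBy B (↑T : Set ι)) (hWA : W ⊆ A) (hWB : W ⊆ B) :
    (prodBernoulli p).real W * (prodBernoulli p).real (A ∩ U) ≤
      (prodBernoulli p).real A * ((prodBernoulli p).real (W ∩ U) + (prodBernoulli p).real (A ∩ B ∩ U)
        - (prodBernoulli p).real A * (prodBernoulli p).real (B ∩ U)) := by
  have hB' : DeterminedBy B (↑(Tᶜ) : Set ι)ᶜ := by simpa using hBT
  have hA' : DeterminedBy A (↑(Tᶜ) : Set ι) := by simpa using hAT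
  have h := endpoint_row_real p Tᶜ hA hW hU hB' hA' hWB hWA
  rw [Set.inter_comm B A] at h
  exact h

/-! ### The elementary interpolation between the two endpoint rows -/

/-- **Endpoint interpolation.**  If `X, α, β ≥ 0`, `0 ≤ h₀ ≤ a`, `0 ≤ h₁ ≤ b`, `h₀h₁ ≤ w ≤ ab` and the two endpoint rows
`a²α + wβ ≤ aX`, `wα + b²β ≤ bX` hold, then `h₀α + h₁β ≤ X`.  (The linear form `h₀α + h₁β` over the region
`{h₀ ≤ a, h₁ ≤ b, h₀h₁ ≤ w}` is maximised at one of the corners `(a, w/a)`, `(w/b, b)`; division-free proof via the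
inequality `a h₁ + b h₀ ≤ ab + w`.) [this work] -/
theorem endpoint_interpolation {X α β a b w h₀ h₁ : ℝ} (hX : 0 ≤ X) (hα : 0 ≤ α) (hβ : 0 ≤ β)
    (h0 : 0 ≤ h₀) (h1 : 0 ≤ h₁) (h0a : h₀ ≤ a) (h1b : h₁ ≤ b) (hw : h₀ * h₁ ≤ w) (hwab : w ≤ a * b)
    (R1 : a * a * α + w * β ≤ a * X) (R2 : w * α + b * b * β ≤ b * X) :
    h₀ * α + h₁ * β ≤ X := by
  have ha : 0 ≤ a := h0.trans h0a
  have hb : 0 ≤ b := h1.trans h1b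
  have hw0 : 0 ≤ w := (mul_nonneg h0 h1).trans hw
  have key : a * h₁ + b * h₀ ≤ a * b + w := by nlinarith [mul_nonneg (sub_nonneg.2 h0a) (sub_nonneg.2 h1b)]
  rcases le_or_gt (b * h₀) w with c1 | c1
  · -- the `R2` corner dominates … unless `b = 0`
    rcases lt_or_ge 0 b with hbpos | hble
    · have hbb : b * (h₀ * α + h₁ * β) ≤ b * X := by
        nlinarith [mul_le_mul_of_nonneg_right c1 hα, mul_le_mul_of_nonneg_right h1b (mul_nonneg hb hβ)]
      exact le_of_mul_le_mul_left hbb hbpos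
    · have hb0 : b = 0 := le_antisymm hble hb
      have hh1 : h₁ = 0 := le_antisymm (hb0 ▸ h1b) h1
      subst hb0; subst hh1
      rcases lt_or_ge 0 a with hapos | hale
      · have haa : a * (h₀ * α) ≤ a * X := by
          nlinarith [mul_le_mul_of_nonneg_right h0a (mul_nonneg ha hα), mul_nonneg hw0 hβ]
        have := le_of_mul_le_mul_left haa hapos
        linarith
      · have ha0 : a = 0 := le_antisymm hale ha
        have hh0 : h₀ = 0 := le_antisymm (ha0 ▸ h0a) h0
        subst hh0; linarith
  · -- `b h₀ > w`: combine `(b h₀ − w)·R1 + a(a − h₀)·R2`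
    have hbpos : 0 < b := by
      by_contra hcon
      have : b = 0 := le_antisymm (not_lt.1 hcon) hb
      rw [this, zero_mul] at c1
      exact absurd c1 (not_lt.2 hw0)
    have h0pos : 0 < h₀ := by
      by_contra hcon
      have : h₀ = 0 := le_antisymm (not_lt.1 hcon) h0
      rw [this, mul_zero] at c1
      exact absurd c1 (not_lt.2 hw0)
    have hapos : 0 < a := h0pos.trans_le h0a
    have hD : 0 < a * b - w := by nlinarith [mul_le_mul_of_nonneg_left h0a hb]
    have e1 := mul_le_mul_of_nonneg_left R1 (sub_nonneg.2 c1.le)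
    have e2 := mul_le_mul_of_nonneg_left R2 (mul_nonneg ha (sub_nonneg.2 h0a))
    have e3 : 0 ≤ (a * b - w) * (a * b + w - a * h₁ - b * h₀) * β :=
      mul_nonneg (mul_nonneg hD.le (by linarith)) hβ
    have hcomb : a * (a * b - w) * (h₀ * α + h₁ * β) ≤ a * (a * b - w) * X := by nlinarith [e1, e2, e3]
    exact le_of_mul_le_mul_left hcomb (mul_pos hapos hD)

/-! ### PLUS′ for independent tops -/

/-- **THEOREM (PLUS′ FOR INDEPENDENT TOPS).**  Let `μ = prodBernoulli q` on a finite cube, `H_i ⊆ G_i` (`i = 0,1,2`) nested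
increasing events, and suppose `G 0` is determined by the coins outside a set `T` and `G 1` by the coins in `T`.  Then
`0 ≤ twoLevelForm μ G H − ∏_i (μ(G_i) − μ(H_i)) − r₂(G,H)` — the conjecture `SahiTwoLevelPlusPrime` holds at `(G,H)`, for every
increasing `G 2` and all nested increasing bottoms `H`. [this work] -/
theorem twoLevelPlusPrime_nonneg_of_determinedBy (q : ι → unitInterval) (T : Finset ι) (G H : Fin 3 → Set (Set ι))
    (hG : ∀ i, IsUpperSet (G i)) (hH : ∀ i, IsUpperSet (H i)) (hHG : ∀ i, H i ⊆ G i)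
    (h0 : DeterminedBy (G 0) (↑T : Set ι)ᶜ) (h1 : DeterminedBy (G 1) (↑T : Set ι)) :
    0 ≤ twoLevelForm (fun A => (prodBernoulli q).real A) G H
          - ∏ i, ((prodBernoulli q).real (G i) - (prodBernoulli q).real (H i))
          - twoLevelSlack (fun A => (prodBernoulli q).real A) G H := by
  rw [twoLevelPlusPrime_eq]
  simp only [thirdCentralMoment]
  have hm : ∀ X : Set (Set ι), MeasurableSet X := fun _ => MeasurableSet.of_discrete
  -- independence of the two tops
  have hind : (prodBernoulli q).real (G 0 ∩ G 1) = (prodBernoulli q).real (G 0) * (prodBernoulli q).real (G 1) := by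
    have h := prodBernoulli_real_inter_of_determinedBy q T h1 h0 (hm _) (hm _)
    rw [Set.inter_comm] at h
    rw [h, mul_comm]
  -- Harris
  have cA := prodBernoulli_harris q (hG 0) (hG 2) (hm _) (hm _)
  have cB := prodBernoulli_harris q (hG 1) (hG 2) (hm _) (hm _)
  have cAB := prodBernoulli_harris q ((hG 0).inter (hG 1)) (hG 2) (hm _) (hm _)
  rw [hind] at cAB
  have cW := prodBernoulli_harris q ((hH 0).inter (hH 1)) (hG 2) (hm _) (hm _)
  have c12 := prodBernoulli_harris q ((hH 1).inter (hH 2)) (hG 0) (hm _) (hm _)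
  have c02 := prodBernoulli_harris q ((hH 0).inter (hH 2)) (hG 1) (hm _) (hm _)
  have c01 := prodBernoulli_harris q (hH 0) (hH 1) (hm _) (hm _)
  -- monotonicity and nonnegativity
  have h0a : (prodBernoulli q).real (H 0) ≤ (prodBernoulli q).real (G 0) := measureReal_mono (hHG 0)
  have h1b : (prodBernoulli q).real (H 1) ≤ (prodBernoulli q).real (G 1) := measureReal_mono (hHG 1)
  have hwab : (prodBernoulli q).real (H 0 ∩ H 1) ≤ (prodBernoulli q).real (G 0) * (prodBernoulli q).real (G 1) := by
    rw [← hind]; exact measureReal_mono (Set.inter_subset_inter (hHG 0) (hHG 1))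
  have n0 : 0 ≤ (prodBernoulli q).real (H 0) := measureReal_nonneg
  have n1 : 0 ≤ (prodBernoulli q).real (H 1) := measureReal_nonneg
  -- the two endpoint rows
  have hWA : H 0 ∩ H 1 ⊆ G 0 := Set.inter_subset_left.trans (hHG 0)
  have hWB : H 0 ∩ H 1 ⊆ G 1 := Set.inter_subset_right.trans (hHG 1)
  have R2 := endpoint_row_real q T (U := G 2) (hG 1) ((hH 0).inter (hH 1)) (hG 2) h0 h1 hWA hWB
  have R1 := endpoint_row_real' q T (U := G 2) (hG 0) ((hH 0).inter (hH 1)) (hG 2) h0 h1 hWA hWB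
  rw [hind]
  -- names
  set a := (prodBernoulli q).real (G 0) with ha
  set b := (prodBernoulli q).real (G 1) with hb
  set u := (prodBernoulli q).real (G 2) with hu
  set w := (prodBernoulli q).real (H 0 ∩ H 1) with hw
  set h₀ := (prodBernoulli q).real (H 0) with hh0
  set h₁ := (prodBernoulli q).real (H 1) with hh1
  set mABU := (prodBernoulli q).real (G 0 ∩ G 1 ∩ G 2) with hmABU
  set mAU := (prodBernoulli q).real (G 0 ∩ G 2) with hmAU
  set mBU := (prodBernoulli q).real (G 1 ∩ G 2) with hmBU
  set mWU := (prodBernoulli q).real (H 0 ∩ H 1 ∩ G 2) with hmWU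
  have main := endpoint_interpolation (X := mABU - a * b * u + (mWU - w * u)) (α := mBU - b * u) (β := mAU - a * u)
    (a := a) (b := b) (w := w) (h₀ := h₀) (h₁ := h₁)
    (by nlinarith [cAB, cW]) (by linarith [cB]) (by linarith [cA]) n0 n1 h0a h1b c01 hwab
    (by nlinarith [R1]) (by nlinarith [R2])
  nlinarith [main, c12, c02]

/-- **`SahiTwoLevelPlus` at every nested pair with independent tops**: `T⁺(G,H) = twoLevelForm μ G H − ∏(μ G_i − μ H_i) ≥ 0`
(indeed `≥ r₂ ≥ 0`). [this work] -/
theorem twoLevelPlus_nonneg_of_determinedBy (q : ι → unitInterval) (T : Finset ι) (G H : Fin 3 → Set (Set ι))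
    (hG : ∀ i, IsUpperSet (G i)) (hH : ∀ i, IsUpperSet (H i)) (hHG : ∀ i, H i ⊆ G i)
    (h0 : DeterminedBy (G 0) (↑T : Set ι)ᶜ) (h1 : DeterminedBy (G 1) (↑T : Set ι)) :
    0 ≤ twoLevelForm (fun A => (prodBernoulli q).real A) G H
          - ∏ i, ((prodBernoulli q).real (G i) - (prodBernoulli q).real (H i)) := by
  linarith [twoLevelPlusPrime_nonneg_of_determinedBy q T G H hG hH hHG h0 h1, twoLevelSlack_nonneg q G H hHG]

/-- **`SahiTwoLevelMinus` (the bottom form) at every nested pair with independent tops**: `twoLevelForm μ G H ≥ 0`. [this work] -/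
theorem twoLevelForm_nonneg_of_determinedBy (q : ι → unitInterval) (T : Finset ι) (G H : Fin 3 → Set (Set ι))
    (hG : ∀ i, IsUpperSet (G i)) (hH : ∀ i, IsUpperSet (H i)) (hHG : ∀ i, H i ⊆ G i)
    (h0 : DeterminedBy (G 0) (↑T : Set ι)ᶜ) (h1 : DeterminedBy (G 1) (↑T : Set ι)) :
    0 ≤ twoLevelForm (fun A => (prodBernoulli q).real A) G H := by
  have hprod : 0 ≤ ∏ i, ((prodBernoulli q).real (G i) - (prodBernoulli q).real (H i)) :=
    prod_nonneg fun i _ => sub_nonneg.2 (measureReal_mono (hHG i))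
  linarith [twoLevelPlus_nonneg_of_determinedBy q T G H hG hH hHG h0 h1]

end SahiTwoLevelIndep

end Summit.CriticalPhenomena.PercolationContinuityZ3.Theorems
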